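import Summits.RiemannHypothesis.RiemannHypothesis.Theorems.Splittings.JensenX4NewmanDeriv

/-!
# Splittings — X-4 × NEWMAN FOR EVERY DERIVATIVE, part 1/3: the normalised derivatives `Ψ_m` and `Ψ_m = ζ_t + o(1)`
# (SPLIT-jen-neg gen 6; two proof-internal data `def`s `dobL`, `Psi`; no Prop defs)

Cell rh-split (brief sha16 f79c5f09d8bcb036), seat rh-split-jen-neg g6 (planner-rh-split-jen-neg-g6-0), card
`run/shared/lean/pub/rh-split/cards/SPLIT-jen-neg.md` ADDENDUM 7 (booked by the lead, ruling #42, 07:01Z; PRE-FILE OFFER accepted as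
lane (xvi)); cut by the seat from `HOME/rh-split-jen-neg/g6/SketchG6AllDerivDelta.lean` (revision 3; declarations byte-identical to it;
the seat's combined file checks rc 0 / 0 warnings / 0 sorries on the farm, standard axioms).  THREE-FILE split forced by the 400-line
rule: part 1 = §G6.1–G6.3 (`Splittings/JensenX4NewmanAllDerivPsi.lean`), part 2 = §G6.4–G6.6 (`Splittings/JensenX4NewmanAllDeriv.lean`),
part 3 = §G6.7–G6.9 (`Splittings/JensenX4KiKimLeeChain.lean`); namespace `…Splittings.JensenX4NewmanAllDeriv` in all three.

Content of this part.  §G6.1 the affine dictionary `iteratedDeriv_xiDeformed_eq : ξ_t^{(m)}(w) = 8(−2i)^m H_t^{(m)}(−i(2w−1))`;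
§G6.2 `dobL t s := γ_t′(s)/γ_t(s)` and the NORMALISED DERIVATIVES `Psi t m s := ξ_t^{(m)}(J_t s)/(γ_t(s)·L(s)^m)`, analyticity of
`γ_t` on the upper half plane, `norm_dobL_ge` (`|L| → ∞` up every strip, from part 2/2 of gen 4, `dobnerGammaT_deriv_growth`), the
exact recursion `psi_succ : (1 + (|t|/4)·s⁻¹)·Ψ_{m+1}(s) = Ψ_m(s) − m·(1/L)′(s)·Ψ_m(s) + Ψ_m′(s)/L(s)` and Cauchy's estimate on unit
discs; §G6.3 `psi_approx : ∀ m, ∀ a ≤ b, ∀ ε > 0, ∃ y₀, ∀ s, a ≤ Re s ≤ b → y₀ ≤ Im s → ‖Ψ_m(s) − ζ_t(s)‖ ≤ ε` (`t < 0`), by induction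
on `m` from Dobner's Theorem 4 (`dobner_xiDeformed_approx_holds`).  Parts 2 and 3 turn this into Newman's conjecture for every
derivative `H_t^{(m)}`, the Hadamard-free Laguerre ladder and the Ki–Kim–Lee chain `0 ≤ λ_{m+1} ≤ λ_m ≤ Λ`.

HONEST LABEL: «SPLITTING SEARCH over kernel-typed RH-EQUIVALENCES; a splitting A ∧ B ⟹ RH is CONDITIONAL bookkeeping unless A and B are
both proved; nothing here bears on the truth of RH.»
-/

set_option linter.dupNamespace false

noncomputable section

open Complex Filter Set Topology Metric

namespace Summit.RiemannHypothesis.RiemannHypothesis.Theorems.Splittings.JensenX4NewmanAllDeriv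

open Literature Literature.NumberTheory.LFunctions
open Summit.RiemannHypothesis.RiemannHypothesis.Theorems.Splittings.JensenX4NewmanDeriv

/-! ## G6.1  The affine dictionary for iterated derivatives: `ξ_t^{(m)}(w) = 8(−2i)^m H_t^{(m)}(−i(2w−1))` -/

/-- Every iterated derivative `H_t^{(m)}` is entire. -/
theorem differentiable_iteratedDeriv_deBruijnH (t : ℝ) (m : ℕ) :
    Differentiable ℂ (iteratedDeriv m (deBruijnH t)) :=
  ((differentiable_deBruijnH_holds t).contDiff (n := ⊤)).differentiable_iteratedDeriv m (WithTop.coe_lt_top _)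

/-- Every iterated derivative of the deformed `ξ_t` (`xiDeformed t`) is entire. -/
theorem differentiable_iteratedDeriv_xiDeformed (t : ℝ) (m : ℕ) :
    Differentiable ℂ (iteratedDeriv m (xiDeformed t)) :=
  ((differentiable_xiDeformed t).contDiff (n := ⊤)).differentiable_iteratedDeriv m (WithTop.coe_lt_top _)

/-- Chain rule, iterated: `ξ_t^{(m)}(w) = 8 (−2i)^m H_t^{(m)}(−i(2w − 1))` as functions. -/
theorem iteratedDeriv_xiDeformed_eq (t : ℝ) (m : ℕ) :
    iteratedDeriv m (xiDeformed t) =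
      fun w ↦ 8 * (-I * 2) ^ m * iteratedDeriv m (deBruijnH t) (-I * (2 * w - 1)) := by
  induction m with
  | zero =>
    funext w
    simp [iteratedDeriv_zero, xiDeformed_eq]
  | succ m ih =>
    funext w
    rw [iteratedDeriv_succ, ih]
    have hH : HasDerivAt (iteratedDeriv m (deBruijnH t))
        (iteratedDeriv (m + 1) (deBruijnH t) (-I * (2 * w - 1))) (-I * (2 * w - 1)) := by
      rw [iteratedDeriv_succ]
      exact ((differentiable_iteratedDeriv_deBruijnH t m) _).hasDerivAt
    have hlin : HasDerivAt (fun w : ℂ ↦ -I * (2 * w - 1)) (-I * 2) w := by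
      have := ((hasDerivAt_id w).const_mul (2 : ℂ)).sub_const (1 : ℂ)
      simpa using this.const_mul (-I)
    have h2 : HasDerivAt (fun w : ℂ ↦ 8 * (-I * 2) ^ m * iteratedDeriv m (deBruijnH t) (-I * (2 * w - 1)))
        (8 * (-I * 2) ^ m * (iteratedDeriv (m + 1) (deBruijnH t) (-I * (2 * w - 1)) * (-I * 2))) w :=
      (hH.comp w hlin).const_mul _
    rw [h2.deriv]
    ring

/-- Chain rule, iterated, pointwise: `ξ_t^{(m)}(w) = 8 (−2i)^m H_t^{(m)}(−i(2w − 1))`. -/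
theorem iteratedDeriv_xiDeformed_apply (t : ℝ) (m : ℕ) (w : ℂ) :
    iteratedDeriv m (xiDeformed t) w = 8 * (-I * 2) ^ m * iteratedDeriv m (deBruijnH t) (-I * (2 * w - 1)) := by
  rw [iteratedDeriv_xiDeformed_eq]

/-! ## G6.2  The logarithmic derivative `L = γ_t′/γ_t` and the normalised derivatives `Ψ_m` -/

/-- `L_t(s) := γ_t′(s)/γ_t(s)` (proof-internal abbreviation). -/
def dobL (t : ℝ) (s : ℂ) : ℂ := deriv (dobnerGammaT t) s / dobnerGammaT t s

/-- `Ψ_{t,m}(s) := ξ_t^{(m)}(J_t(s)) / (γ_t(s) · L_t(s)^m)` (proof-internal abbreviation). -/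
def Psi (t : ℝ) (m : ℕ) (s : ℂ) : ℂ :=
  iteratedDeriv m (xiDeformed t) (dobnerJ t s) / (dobnerGammaT t s * dobL t s ^ m)

/-- The open upper half-plane `{s | 0 < Im s}` is open. -/
private theorem isOpen_upperHalfPlane' : IsOpen {s : ℂ | 0 < s.im} := isOpen_lt continuous_const Complex.continuous_im

/-- Dobner's `γ_t` (`dobnerGammaT t`) is analytic on the open upper half-plane. -/
theorem analyticOnNhd_dobnerGammaT (t : ℝ) : AnalyticOnNhd ℂ (dobnerGammaT t) {s : ℂ | 0 < s.im} :=
  DifferentiableOn.analyticOnNhd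
    (fun _ hs ↦ (differentiableAt_dobnerGammaT t hs).differentiableWithinAt) isOpen_upperHalfPlane'

/-- `γ_t′` is differentiable at every point of the open upper half-plane. -/
theorem differentiableAt_deriv_dobnerGammaT (t : ℝ) {s : ℂ} (hs : 0 < s.im) :
    DifferentiableAt ℂ (deriv (dobnerGammaT t)) s :=
  ((analyticOnNhd_dobnerGammaT t).deriv_of_isOpen isOpen_upperHalfPlane' s hs).differentiableAt

/-- The logarithmic derivative `L_t = γ_t′/γ_t` (`dobL t`) is differentiable on the open upper half-plane
(`γ_t` has no zeros there). -/
theorem differentiableAt_dobL (t : ℝ) {s : ℂ} (hs : 0 < s.im) : DifferentiableAt ℂ (dobL t) s := by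
  have : dobL t = fun s ↦ deriv (dobnerGammaT t) s / dobnerGammaT t s := rfl
  rw [this]
  exact (differentiableAt_deriv_dobnerGammaT t hs).div (differentiableAt_dobnerGammaT t hs)
    (dobnerGammaT_ne_zero t hs.ne')

/-- `γ_t′ = γ_t · L_t` on the open upper half-plane. -/
theorem hasDerivAt_dobnerGammaT_dobL (t : ℝ) {s : ℂ} (hs : 0 < s.im) :
    HasDerivAt (dobnerGammaT t) (dobnerGammaT t s * dobL t s) s := by
  have h := (differentiableAt_dobnerGammaT t hs).hasDerivAt
  have e : dobnerGammaT t s * dobL t s = deriv (dobnerGammaT t) s := by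
    rw [dobL, mul_div_cancel₀ _ (dobnerGammaT_ne_zero t hs.ne')]
  rw [e]
  exact h

/-- T3 restated: `|L_t| → ∞` on every vertical strip. -/
theorem norm_dobL_ge {t : ℝ} (ht : t < 0) (a b : ℝ) (hab : a ≤ b) (K : ℝ) :
    ∃ y₁ : ℝ, 0 < y₁ ∧ ∀ s : ℂ, a ≤ s.re → s.re ≤ b → y₁ ≤ s.im → K ≤ ‖dobL t s‖ := by
  obtain ⟨y₁, hy₁, h⟩ := dobnerGammaT_deriv_growth ht a b hab K
  refine ⟨y₁, hy₁, fun s h1 h2 h3 ↦ ?_⟩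
  have hγ : dobnerGammaT t s ≠ 0 := dobnerGammaT_ne_zero t (by linarith : s.im ≠ 0)
  have hpos : 0 < ‖dobnerGammaT t s‖ := norm_pos_iff.2 hγ
  rw [dobL, norm_div, le_div_iff₀ hpos]
  exact h s h1 h2 h3

/-- Chain rule: `d/ds ξ_t^{(m)}(J_t s) = ξ_t^{(m+1)}(J_t s) · J_t′(s)`. -/
theorem hasDerivAt_phi (t : ℝ) (m : ℕ) {s : ℂ} (hs : 0 < s.im) :
    HasDerivAt (fun z ↦ iteratedDeriv m (xiDeformed t) (dobnerJ t z))
      (iteratedDeriv (m + 1) (xiDeformed t) (dobnerJ t s) * (1 + (|t| / 4 : ℝ) * s⁻¹)) s := by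
  have h1 : HasDerivAt (iteratedDeriv m (xiDeformed t))
      (iteratedDeriv (m + 1) (xiDeformed t) (dobnerJ t s)) (dobnerJ t s) := by
    rw [iteratedDeriv_succ]
    exact ((differentiable_iteratedDeriv_xiDeformed t m) _).hasDerivAt
  exact h1.comp s (hasDerivAt_dobnerJ t hs)

/-- The normalised derivative `Ψ_{t,m} = H_t^{(m)}∘(…) / (γ_t L_t^m)` (`Psi t m`) is differentiable wherever `L_t ≠ 0`
in the open upper half-plane. -/
theorem differentiableAt_psi (t : ℝ) (m : ℕ) {s : ℂ} (hs : 0 < s.im) (hL : dobL t s ≠ 0) :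
    DifferentiableAt ℂ (Psi t m) s := by
  have : Psi t m = fun z ↦
      iteratedDeriv m (xiDeformed t) (dobnerJ t z) / (dobnerGammaT t z * dobL t z ^ m) := rfl
  rw [this]
  refine DifferentiableAt.div ?_ ?_ ?_
  · exact ((differentiable_iteratedDeriv_xiDeformed t m) _).comp s (differentiableAt_dobnerJ t hs)
  · exact (differentiableAt_dobnerGammaT t hs).mul ((differentiableAt_dobL t hs).pow m)
  · exact mul_ne_zero (dobnerGammaT_ne_zero t hs.ne') (pow_ne_zero m hL)

/-- **The recursion.** `J_t′(s) Ψ_{m+1}(s) = Ψ_m(s) − m (1/L)′(s) Ψ_m(s) + Ψ_m′(s)/L(s)` wherever `L(s) ≠ 0`. -/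
theorem psi_succ (t : ℝ) (m : ℕ) {s : ℂ} (hs : 0 < s.im) (hL : dobL t s ≠ 0) :
    (1 + (|t| / 4 : ℝ) * s⁻¹) * Psi t (m + 1) s =
      Psi t m s - m * deriv (fun z ↦ (dobL t z)⁻¹) s * Psi t m s + deriv (Psi t m) s / dobL t s := by
  have hγ0 : dobnerGammaT t s ≠ 0 := dobnerGammaT_ne_zero t hs.ne'
  have hs0 : s ≠ 0 := fun h ↦ by simp [h] at hs
  -- derivative data
  have hγd : HasDerivAt (dobnerGammaT t) (dobnerGammaT t s * dobL t s) s :=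
    hasDerivAt_dobnerGammaT_dobL t hs
  have hLd : HasDerivAt (dobL t) (deriv (dobL t) s) s := (differentiableAt_dobL t hs).hasDerivAt
  have hΨd : HasDerivAt (Psi t m) (deriv (Psi t m) s) s := (differentiableAt_psi t m hs hL).hasDerivAt
  have hinv : HasDerivAt (fun z ↦ (dobL t z)⁻¹) (-deriv (dobL t) s / dobL t s ^ 2) s := hLd.inv hL
  have hDd : HasDerivAt (fun z ↦ dobnerGammaT t z * dobL t z ^ m)
      (dobnerGammaT t s * dobL t s * dobL t s ^ m +
        dobnerGammaT t s * ((m : ℂ) * dobL t s ^ (m - 1) * deriv (dobL t) s)) s :=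
    hγd.mul (hLd.pow m)
  have hD0 : dobnerGammaT t s * dobL t s ^ m ≠ 0 := mul_ne_zero hγ0 (pow_ne_zero m hL)
  -- `ξ_t^{(m)} ∘ J_t = (γ_t L^m) · Ψ_m` near `s`
  have hev : (fun z ↦ iteratedDeriv m (xiDeformed t) (dobnerJ t z)) =ᶠ[𝓝 s]
      fun z ↦ (dobnerGammaT t z * dobL t z ^ m) * Psi t m z := by
    filter_upwards [hDd.continuousAt.eventually_ne hD0] with z hz
    rw [Psi, mul_div_cancel₀ _ hz]
  have hΦ' := (hasDerivAt_phi t m hs).deriv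
  have hΦd : deriv (fun z ↦ iteratedDeriv m (xiDeformed t) (dobnerJ t z)) s =
      (dobnerGammaT t s * dobL t s * dobL t s ^ m +
        dobnerGammaT t s * ((m : ℂ) * dobL t s ^ (m - 1) * deriv (dobL t) s)) * Psi t m s +
      (dobnerGammaT t s * dobL t s ^ m) * deriv (Psi t m) s := by
    rw [hev.deriv_eq]
    exact (hDd.mul hΨd).deriv
  have key := hΦ'.symm.trans hΦd
  set q : ℂ := 1 + ((|t| / 4 : ℝ) : ℂ) * s⁻¹ with hq
  have hq0 : q ≠ 0 := by
    intro h
    have h2 : s + ((|t| / 4 : ℝ) : ℂ) = 0 := by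
      have := congrArg (fun z ↦ s * z) h
      simp only [hq, mul_add, mul_one, mul_zero] at this
      rwa [mul_left_comm, mul_inv_cancel₀ hs0, mul_one] at this
    have := congrArg Complex.im h2
    simp at this
    linarith
  rw [show Psi t (m + 1) s = iteratedDeriv (m + 1) (xiDeformed t) (dobnerJ t s) /
      (dobnerGammaT t s * dobL t s ^ (m + 1)) from rfl, eq_div_of_mul_eq hq0 key, hinv.deriv]
  rcases Nat.eq_zero_or_pos m with rfl | hm
  · simp only [pow_zero, Nat.cast_zero, zero_mul, mul_zero, add_zero, mul_one, sub_zero,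
      zero_add, pow_one]
    field_simp
  · obtain ⟨k, rfl⟩ := Nat.exists_eq_add_one_of_ne_zero hm.ne'
    simp only [Nat.add_sub_cancel]
    field_simp
    ring

/-- Cauchy's estimate on the closed unit disc. -/
theorem norm_deriv_le_of_closedBall {f : ℂ → ℂ} {s : ℂ} {C : ℝ}
    (hd : ∀ z ∈ closedBall s 1, DifferentiableAt ℂ f z) (hC : ∀ z ∈ sphere s 1, ‖f z‖ ≤ C) :
    ‖deriv f s‖ ≤ C := by
  have hdc : DiffContOnCl ℂ f (ball s 1) := by
    apply DifferentiableOn.diffContOnCl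
    rw [closure_ball s one_ne_zero]
    exact fun z hz ↦ (hd z hz).differentiableWithinAt
  have := Complex.norm_deriv_le_of_forall_mem_sphere_norm_le one_pos hdc hC
  simpa using this

/-! ## G6.3  `Ψ_m = ζ_t + o(1)` on vertical strips, for every `m` (induction) -/

/-- **Normalised derivatives approximate `ζ_t`.**  For every `m`, on every vertical strip,
`‖Ψ_m(s) − ζ_t(s)‖ → 0` as `Im s → ∞`.  Base: Dobner's Theorem 4; step: the recursion `psi_succ`,
two Cauchy estimates (`Ψ_m′ = O(1)`, `(1/L)′ → 0`) and T3 (`|L| → ∞`). -/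
theorem psi_approx {t : ℝ} (ht : t < 0) (m : ℕ) :
    ∀ a b : ℝ, a ≤ b → ∀ ε : ℝ, 0 < ε → ∃ y₀ : ℝ, ∀ s : ℂ, a ≤ s.re → s.re ≤ b → y₀ ≤ s.im →
      ‖Psi t m s - zetaDeformed t s‖ ≤ ε := by
  have ht' : 0 < |t| := abs_pos.2 ht.ne
  induction m with
  | zero =>
    intro a b hab ε hε
    obtain ⟨y, hy⟩ := dobner_xiDeformed_approx_holds t ht a b hab ε hε
    refine ⟨max y 1, fun s h1 h2 h3 ↦ ?_⟩
    have hs : 0 < s.im := by linarith [le_max_right y 1]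
    have hγ0 := dobnerGammaT_ne_zero t hs.ne'
    have h := hy s h1 h2 ((le_max_left _ _).trans h3)
    have e : Psi t 0 s - zetaDeformed t s =
        (xiDeformed t (dobnerJ t s) - dobnerGammaT t s * zetaDeformed t s) / dobnerGammaT t s := by
      simp only [Psi, iteratedDeriv_zero, pow_zero, mul_one]
      field_simp
    rw [e, norm_div, div_le_iff₀ (norm_pos_iff.2 hγ0)]
    exact h
  | succ m ih =>
    intro a b hab ε hε
    obtain ⟨Z, hZ⟩ := exists_norm_zetaDeformed_le_of_le_re ht (a - 1)
    have hZ0 : 0 ≤ Z := (norm_nonneg _).trans (hZ (a : ℂ) (by simp))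
    obtain ⟨K₀, hK₀def⟩ : ∃ K₀ : ℝ, K₀ = 8 * (m + 1) * (Z + 1) / ε + 1 := ⟨_, rfl⟩
    have hK₀pos : 0 < K₀ := by rw [hK₀def]; positivity
    have hK₀1 : 1 ≤ K₀ := by
      rw [hK₀def]
      have : 0 ≤ 8 * (m + 1 : ℝ) * (Z + 1) / ε := by positivity
      linarith
    -- heights
    obtain ⟨yw, hyw⟩ := ih (a - 1) (b + 1) (by linarith) 1 one_pos
    obtain ⟨yn, hyn⟩ := ih a b hab (ε / 8) (by positivity)
    obtain ⟨yK, hyK, hK⟩ := norm_dobL_ge ht (a - 1) (b + 1) (by linarith) K₀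
    refine ⟨max (max (yw + 1) (yK + 1)) (max yn (2 * |t| * (Z + 1) / ε + |t| / 2)),
      fun s h1 h2 h3 ↦ ?_⟩
    have hs_w : yw + 1 ≤ s.im := ((le_max_left _ _).trans (le_max_left _ _)).trans h3
    have hs_K : yK + 1 ≤ s.im := ((le_max_right _ _).trans (le_max_left _ _)).trans h3
    have hs_n : yn ≤ s.im := ((le_max_left _ _).trans (le_max_right _ _)).trans h3
    have hs_c : 2 * |t| * (Z + 1) / ε + |t| / 2 ≤ s.im :=
      ((le_max_right _ _).trans (le_max_right _ _)).trans h3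
    have hs_im : 0 < s.im := by linarith
    have hsnorm : s.im ≤ ‖s‖ := (le_abs_self _).trans (abs_im_le_norm s)
    -- the closed unit disc around `s`
    have hdisc : ∀ z ∈ closedBall s 1,
        a - 1 ≤ z.re ∧ z.re ≤ b + 1 ∧ yw ≤ z.im ∧ yK ≤ z.im ∧ 0 < z.im := by
      intro z hz
      obtain ⟨e1, e2⟩ := abs_re_im_sub_le_of_mem_closedBall hz
      have e1' := abs_le.1 e1
      have e2' := abs_le.1 e2
      refine ⟨by linarith, by linarith, by linarith, by linarith, by linarith⟩
    have hLz : ∀ z ∈ closedBall s 1, K₀ ≤ ‖dobL t z‖ := fun z hz ↦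
      hK z (hdisc z hz).1 (hdisc z hz).2.1 (hdisc z hz).2.2.2.1
    have hLne : ∀ z ∈ closedBall s 1, dobL t z ≠ 0 := by
      intro z hz h0
      have := hLz z hz
      rw [h0, norm_zero] at this
      linarith
    have hΨbd : ∀ z ∈ closedBall s 1, ‖Psi t m z‖ ≤ Z + 1 := by
      intro z hz
      obtain ⟨e1, e2, e3, -, -⟩ := hdisc z hz
      have d1 := hyw z e1 e2 e3
      have d2 := hZ z e1
      calc ‖Psi t m z‖ = ‖zetaDeformed t z + (Psi t m z - zetaDeformed t z)‖ := by ring_nf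
        _ ≤ ‖zetaDeformed t z‖ + ‖Psi t m z - zetaDeformed t z‖ := norm_add_le _ _
        _ ≤ Z + 1 := add_le_add d2 d1
    -- Cauchy estimate 1: `‖Ψ_m′(s)‖ ≤ Z + 1`
    have hC1 : ‖deriv (Psi t m) s‖ ≤ Z + 1 :=
      norm_deriv_le_of_closedBall
        (fun z hz ↦ differentiableAt_psi t m (hdisc z hz).2.2.2.2 (hLne z hz))
        (fun z hz ↦ hΨbd z (sphere_subset_closedBall hz))
    -- Cauchy estimate 2: `‖(1/L)′(s)‖ ≤ 1/K₀`
    have hC2 : ‖deriv (fun z ↦ (dobL t z)⁻¹) s‖ ≤ 1 / K₀ :=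
      norm_deriv_le_of_closedBall
        (fun z hz ↦ (differentiableAt_dobL t (hdisc z hz).2.2.2.2).inv (hLne z hz))
        (fun z hz ↦ by
          rw [norm_inv, ← one_div]
          exact one_div_le_one_div_of_le hK₀pos (hLz z (sphere_subset_closedBall hz)))
    -- point data at `s`
    have hs_mem : s ∈ closedBall s 1 := mem_closedBall_self zero_le_one
    have hsL : K₀ ≤ ‖dobL t s‖ := hLz s hs_mem
    have hsL0 : dobL t s ≠ 0 := hLne s hs_mem
    have hΨs : ‖Psi t m s‖ ≤ Z + 1 := hΨbd s hs_mem
    have hζs : ‖zetaDeformed t s‖ ≤ Z := hZ s (by linarith)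
    have hn : ‖Psi t m s - zetaDeformed t s‖ ≤ ε / 8 := hyn s h1 h2 hs_n
    -- the recursion at `s`
    have hid := psi_succ t m hs_im hsL0
    set x : ℂ := ((|t| / 4 : ℝ) : ℂ) * s⁻¹ with hx
    set q : ℂ := 1 + x with hq
    -- `J_t′(s) = q = 1 + x`, `‖x‖ ≤ |t|/(4 Im s) ≤ 1/2`
    have hx_small : ‖x‖ ≤ |t| / 4 / s.im := by
      rw [hx, norm_mul, norm_inv, Complex.norm_real, Real.norm_eq_abs,
        abs_of_pos (by positivity : (0 : ℝ) < |t| / 4), ← div_eq_mul_inv]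
      exact div_le_div_of_nonneg_left (by positivity) hs_im hsnorm
    have hx_half : ‖x‖ ≤ 1 / 2 := by
      refine hx_small.trans ?_
      rw [div_le_iff₀ hs_im]
      have : 0 ≤ 2 * |t| * (Z + 1) / ε := by positivity
      linarith
    have hq_norm : 1 / 2 ≤ ‖q‖ := by
      have e : ‖(1 : ℂ)‖ ≤ ‖1 + x‖ + ‖x‖ := by
        calc ‖(1 : ℂ)‖ = ‖(1 + x) - x‖ := by rw [add_sub_cancel_right]
          _ ≤ ‖1 + x‖ + ‖x‖ := norm_sub_le _ _
      rw [norm_one] at e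
      rw [hq]
      linarith
    have hq0 : q ≠ 0 := by
      intro h
      rw [h, norm_zero] at hq_norm
      linarith
    have hqinv : ‖q⁻¹‖ ≤ 2 := by
      rw [norm_inv, ← one_div]
      calc 1 / ‖q‖ ≤ 1 / (1 / 2) := one_div_le_one_div_of_le (by norm_num) hq_norm
        _ = 2 := by norm_num
    -- rewrite `Ψ_{m+1} − ζ_t`
    have hΨsucc : Psi t (m + 1) s = q⁻¹ * (Psi t m s - m * deriv (fun z ↦ (dobL t z)⁻¹) s * Psi t m s +
        deriv (Psi t m) s / dobL t s) := (eq_inv_mul_iff_mul_eq₀ hq0).2 hid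
    have hexpr : Psi t (m + 1) s - zetaDeformed t s =
        q⁻¹ * ((Psi t m s - zetaDeformed t s) - x * zetaDeformed t s
          - m * deriv (fun z ↦ (dobL t z)⁻¹) s * Psi t m s + deriv (Psi t m) s / dobL t s) := by
      rw [hΨsucc]
      have e1 : ∀ R : ℂ, q⁻¹ * R - zetaDeformed t s = q⁻¹ * (R - q * zetaDeformed t s) := by
        intro R
        rw [mul_sub, ← mul_assoc, inv_mul_cancel₀ hq0, one_mul]
      rw [e1, hq]
      ring
    -- the four pieces
    have hBn : ‖x * zetaDeformed t s‖ ≤ |t| / 4 / s.im * Z := by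
      rw [norm_mul]
      exact mul_le_mul hx_small hζs (norm_nonneg _) (by positivity)
    have hCn : ‖(m : ℂ) * deriv (fun z ↦ (dobL t z)⁻¹) s * Psi t m s‖ ≤ m * (1 / K₀) * (Z + 1) := by
      rw [norm_mul, norm_mul, Complex.norm_natCast]
      refine mul_le_mul (mul_le_mul_of_nonneg_left hC2 (Nat.cast_nonneg m)) hΨs (norm_nonneg _) ?_
      exact mul_nonneg (Nat.cast_nonneg m) (one_div_nonneg.2 hK₀pos.le)
    have hDn : ‖deriv (Psi t m) s / dobL t s‖ ≤ (Z + 1) / K₀ := by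
      rw [norm_div]
      exact (div_le_div_of_nonneg_right hC1 (norm_nonneg _)).trans
        (div_le_div_of_nonneg_left (by linarith) hK₀pos hsL)
    have htri : ∀ A B C D : ℂ, ‖A - B - C + D‖ ≤ ‖A‖ + ‖B‖ + ‖C‖ + ‖D‖ := by
      intro A B C D
      have e1 := norm_add_le (A - B - C) D
      have e2 := norm_sub_le (A - B) C
      have e3 := norm_sub_le A B
      linarith
    -- numeric bookkeeping
    have hB8 : |t| / 4 / s.im * Z ≤ ε / 8 := by
      rw [div_mul_eq_mul_div, div_le_iff₀ hs_im]
      have e2 : ε / 8 * (2 * |t| * (Z + 1) / ε + |t| / 2) ≤ ε / 8 * s.im :=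
        mul_le_mul_of_nonneg_left hs_c (by positivity)
      have e3 : ε / 8 * (2 * |t| * (Z + 1) / ε + |t| / 2) = |t| * (Z + 1) / 4 + ε * |t| / 16 := by
        field_simp
        ring
      nlinarith [ht'.le, hZ0, hε.le]
    have hCD8 : (m : ℝ) * (1 / K₀) * (Z + 1) + (Z + 1) / K₀ ≤ ε / 8 := by
      have e4 : (m : ℝ) * (1 / K₀) * (Z + 1) + (Z + 1) / K₀ = ((m + 1) * (Z + 1)) / K₀ := by
        field_simp
      rw [e4, div_le_iff₀ hK₀pos]
      have e5 : ε / 8 * K₀ = (m + 1) * (Z + 1) + ε / 8 := by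
        rw [hK₀def]
        field_simp
      nlinarith [hε.le, e5]
    -- conclude
    rw [hexpr, norm_mul]
    have hsum := htri (Psi t m s - zetaDeformed t s) (x * zetaDeformed t s)
      ((m : ℂ) * deriv (fun z ↦ (dobL t z)⁻¹) s * Psi t m s) (deriv (Psi t m) s / dobL t s)
    have hin : ‖(Psi t m s - zetaDeformed t s) - x * zetaDeformed t s
        - (m : ℂ) * deriv (fun z ↦ (dobL t z)⁻¹) s * Psi t m s + deriv (Psi t m) s / dobL t s‖
        ≤ ε / 8 + ε / 8 + ε / 8 := by linarith
    calc ‖q⁻¹‖ * ‖(Psi t m s - zetaDeformed t s) - x * zetaDeformed t s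
          - (m : ℂ) * deriv (fun z ↦ (dobL t z)⁻¹) s * Psi t m s + deriv (Psi t m) s / dobL t s‖
        ≤ 2 * (ε / 8 + ε / 8 + ε / 8) := mul_le_mul hqinv hin (norm_nonneg _) (by norm_num)
      _ ≤ ε := by linarith

end Summit.RiemannHypothesis.RiemannHypothesis.Theorems.Splittings.JensenX4NewmanAllDeriv

end
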